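/-
HONEST FRAMING: certified error envelopes and provably optimal rounding/accumulation schemes for
low-precision formats under stated cost models; every table by two implementations; no hardware
or vendor claims.
-/
import Summits.Ventures.CertifiedArithmetic.LowPrec.OptDemotionRootStep

/-!
# The demotion law (Theorem T8), part 7a: the BUDGET RELAXATION `Φ*` — definitions and grid tools

OPTIMA.md §B T8(b)(iii′)(R1) (opt seat gen 10).  For a summation tree evaluated in `F_q` by ANY
nearest rounding on nonnegative data, a subtree computing the float `c` has exact sum at most
`Φ*_t(c)`, where
`Φ*_leaf(c) = c`, `Φ*_(l·r)(c) = max { Φ*_l(a) + Φ*_r(b) : a, b ∈ F_q ∪ {0}, a, b ≤ c, a + b ≤ c + u·ufp(c) }`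
(the children of a node compute floats `a, b ≤ c` with `a + b ≤ c + ½ulp(c)`).  The relaxation is
scale free (`Φ*(2c) = 2Φ*(c)`) and NONDECREASING in `c`, so it is a finite table per tree: this file
REFLECTS it in Lean as a kernel-computable table `phiTab q s` over the `2^(q-1)` mantissas of one
binade, indexed by the SHAPE `s` of the tree (leaf data are irrelevant).

Why (lean gen 11, 2026-08-21): opt gen 12's certificates C26/C27 show that the line-family cap
`σ·treeQf u t x` of parts 6a–6k over-estimates the true worst case at the non-dyadic knots, so much
that its node step (NS) FAILS at `q = 4` (pair `(chain_N, b*)`), while Conjecture D itself passes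
every exact test.  A cap that satisfies the node step BY CONSTRUCTION is the relaxation `Φ*`; part 7b
proves `exact ≤ Φ*` for every tree and part 7c turns `Φ*_t ≤ Q_t · fl_p` into a kernel-decidable
certificate `budgetCheck q p s`, so that `D_t = Q_t` becomes a Lean theorem for every concrete shape
the kernel can evaluate (all shapes with few leaves, opt's 37-leaf and the 43-leaf GOOD-ACTIVE
counterexample trees, …) at any `(q, p)`.

Contents of part 7a (this file): `Shape`/`shapeOf` (+ invariance of `treeM`/`treeQf` under
`shapeOf`), grid values `n / 2^k` with mantissa `n ∈ [2^(q-1), 2^q)`, and the rounding-down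
operator `bmax` with its specification `bmax_spec` (the largest grid value below
`min (m, m + ½ - a)`).  Part 7a′ (`OptDemotionBudgetTable`): the candidate list, the node evaluator
and the table `phiTab`/`phi`/`phiVal` — the evaluator enumerates the LEFT child over all grid values
`a ≤ m` of depth `≤ q+1` (deeper values are dominated by depth `q+1`) and gives the RIGHT child
`bmax` (exact by monotonicity, part 7b); checked against a brute force over all pairs in
`code/lean/demote_g11/phistar.py`.  Part 7b′: `exact ≤ Φ*`; part 7c: the certificate; part 7d:
kernel instances.
-/

namespace Summit.Ventures.CertifiedArithmetic.LowPrec.Opt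

open Literature.ComputerArithmetic.JeannerodRump2018
open Literature.ComputerArithmetic.JeannerodRump2018.SumTree

/-! ## Shapes -/

/-- The shape of a summation tree (leaf data forgotten). -/
inductive Shape
  | lf : Shape
  | nd : Shape → Shape → Shape
  deriving DecidableEq, Repr

/-- The shape of a `SumTree`. -/
def shapeOf : SumTree → Shape
  | .leaf _ => .lf
  | .node a b => .nd (shapeOf a) (shapeOf b)

/-- A tree of the given shape (all leaves `0`). -/
def Shape.toTree : Shape → SumTree
  | .lf => .leaf 0
  | .nd a b => .node a.toTree b.toTree

/-- Number of leaves of a shape. -/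
def Shape.numLeaves : Shape → ℕ
  | .lf => 1
  | .nd a b => a.numLeaves + b.numLeaves

/-- `shapeOf (s.toTree) = s`. -/
@[simp] theorem shapeOf_toTree : ∀ s : Shape, shapeOf s.toTree = s
  | .lf => rfl
  | .nd a b => by simp [Shape.toTree, shapeOf, shapeOf_toTree a, shapeOf_toTree b]

/-- `shapeOf` of a leaf / node. -/
@[simp] theorem shapeOf_leaf (x : ℚ) : shapeOf (.leaf x) = .lf := rfl
/-- `shapeOf` of a node. -/
@[simp] theorem shapeOf_node (a b : SumTree) : shapeOf (.node a b) = .nd (shapeOf a) (shapeOf b) := rfl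

/-- The tree polynomial depends only on the shape. -/
theorem treeM_eq_of_shapeOf (u : ℚ) : ∀ t t' : SumTree, shapeOf t = shapeOf t' → treeM u t = treeM u t'
  | .leaf _, .leaf _, _ => by simp
  | .leaf _, .node _ _, h => by simp [shapeOf] at h
  | .node _ _, .leaf _, h => by simp [shapeOf] at h
  | .node a b, .node a' b', h => by
      simp only [shapeOf_node, Shape.nd.injEq] at h
      rw [treeM_node, treeM_node, treeM_eq_of_shapeOf u a a' h.1, treeM_eq_of_shapeOf u b b' h.2]

/-- The coupled polynomial depends only on the shape. -/
theorem treeQf_eq_of_shapeOf (u : ℚ) :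
    ∀ t t' : SumTree, shapeOf t = shapeOf t' → ∀ ρ : ℚ, treeQf u t ρ = treeQf u t' ρ
  | .leaf _, .leaf _, _, ρ => by simp
  | .leaf _, .node _ _, h, _ => by simp [shapeOf] at h
  | .node _ _, .leaf _, h, _ => by simp [shapeOf] at h
  | .node a b, .node a' b', h, ρ => by
      simp only [shapeOf_node, Shape.nd.injEq] at h
      rw [treeQf_node, treeQf_node, treeM_eq_of_shapeOf u a a' h.1, treeM_eq_of_shapeOf u b b' h.2,
        treeQf_eq_of_shapeOf u a a' h.1, treeQf_eq_of_shapeOf u b b' h.2,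
        treeQf_eq_of_shapeOf u a a' h.1, treeQf_eq_of_shapeOf u b b' h.2]

/-- `treeM` of a tree is that of its shape's canonical tree. -/
theorem treeM_toTree_shapeOf (u : ℚ) (t : SumTree) : treeM u (shapeOf t).toTree = treeM u t :=
  treeM_eq_of_shapeOf u _ _ (shapeOf_toTree _)

/-- `treeQf` of a tree is that of its shape's canonical tree. -/
theorem treeQf_toTree_shapeOf (u : ℚ) (t : SumTree) (ρ : ℚ) :
    treeQf u (shapeOf t).toTree ρ = treeQf u t ρ :=
  treeQf_eq_of_shapeOf u _ _ (shapeOf_toTree _) ρ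

/-! ## Grid values

A positive float of `F_q` read at the scale of a budget is a GRID VALUE `n / 2^k` with mantissa
`n ∈ [2^(q-1), 2^q)` and depth `k ∈ ℕ` (the budget itself has depth `0` and integer value `m`, so
`ulp = 1`, `½ulp = ½`). -/

/-- The binade of a grid value: `2^(q-1)/2^k ≤ n/2^k < 2^q/2^k`. -/
theorem gridVal_binade {q n k : ℕ} (hn : 2 ^ (q - 1) ≤ n) (hn' : n < 2 ^ q) :
    (2 : ℚ) ^ (q - 1) / 2 ^ k ≤ (n : ℚ) / 2 ^ k ∧ (n : ℚ) / 2 ^ k < (2 : ℚ) ^ q / 2 ^ k := by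
  have hk : (0 : ℚ) < 2 ^ k := by positivity
  constructor
  · exact div_le_div_of_nonneg_right (by exact_mod_cast hn) hk.le
  · exact div_lt_div_of_pos_right (by exact_mod_cast hn') hk

/-- Depth comparison of grid values: if `n/2^k ≤ n'/2^k'` (mantissas in one binade) then `k' ≤ k`. -/
theorem depth_le_of_gridVal_le {q n k n' k' : ℕ} (hn : 2 ^ (q - 1) ≤ n) (hn' : n' < 2 ^ q)
    (hq : 1 ≤ q) (h : (n : ℚ) / 2 ^ k ≤ (n' : ℚ) / 2 ^ k') : k' ≤ k := by
  by_contra hc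
  have hlt : k + 1 ≤ k' := by omega
  have h1 : (2 : ℚ) ^ (q - 1) / 2 ^ k ≤ (n : ℚ) / 2 ^ k :=
    div_le_div_of_nonneg_right (by exact_mod_cast hn) (by positivity)
  have h3 : (n' : ℚ) / 2 ^ k' < (2 : ℚ) ^ q / 2 ^ k' :=
    div_lt_div_of_pos_right (by exact_mod_cast hn') (by positivity)
  have h4 : (2 : ℚ) ^ q / 2 ^ k' ≤ (2 : ℚ) ^ q / 2 ^ (k + 1) :=
    div_le_div_of_nonneg_left (by positivity) (by positivity) (pow_le_pow_right₀ (by norm_num) hlt)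
  have h5 : (2 : ℚ) ^ q / 2 ^ (k + 1) = (2 : ℚ) ^ (q - 1) / 2 ^ k := by
    obtain ⟨e, rfl⟩ : ∃ e, q = e + 1 := ⟨q - 1, by omega⟩
    rw [Nat.add_sub_cancel, pow_succ, pow_succ]
    field_simp
  linarith

/-- Antitonicity in the depth: `x / 2^k' ≤ x / 2^k` for `k ≤ k'`, `x ≥ 0`. -/
theorem div_pow_le_div_pow_of_le {x : ℚ} (hx : 0 ≤ x) {k k' : ℕ} (h : k ≤ k') :
    x / 2 ^ k' ≤ x / 2 ^ k :=
  div_le_div_of_nonneg_left hx (by positivity) (pow_le_pow_right₀ (by norm_num) h)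

/-- Shifting a grid inequality: `n/2^k ≤ n'/2^k'` iff `n/2^(k+j) ≤ n'/2^(k'+j)`. -/
theorem gridVal_le_shift (n k n' k' j : ℕ) :
    (n : ℚ) / 2 ^ (k + j) ≤ (n' : ℚ) / 2 ^ (k' + j) ↔ (n : ℚ) / 2 ^ k ≤ (n' : ℚ) / 2 ^ k' := by
  rw [pow_add, pow_add, ← div_div, ← div_div]
  exact div_le_div_iff_of_pos_right (by positivity)

/-! ## Rounding a budget remainder down to the grid: `bmax`

For a budget mantissa `m ∈ [2^(q-1), 2^q)` (value `m`, half-ulp `½`) and a left grid value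
`a = ma / 2^ja` given by its numerator `A = ma · 2^(q+1-ja)` in units of `2^-(q+1)`, `bmax q m A` is
the LARGEST grid value `≤ min (m, m + ½ - a)`: the budget `m` itself when `a ≤ ½`, and otherwise the
`q`-bit truncation of `y = m + ½ - a` (numerator `Y = m·2^(q+1) + 2^q - A`). -/

/-- The largest grid value below `min (m, m + ½ - a)`, as (mantissa, depth). -/
def bmax (q m A : ℕ) : ℕ × ℕ :=
  if A ≤ 2 ^ q then (m, 0)
  else
    let Y := m * 2 ^ (q + 1) + 2 ^ q - A
    (Y / 2 ^ (Nat.log2 Y + 1 - q), 2 * q - Nat.log2 Y)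

/-- Truncation facts: for `2^q ≤ Y < 2^(2q+1)`, with `L = log₂ Y`, `s = L + 1 - q`, `mb = Y / 2^s`,
`jb = 2q - L`: `mb ∈ [2^(q-1), 2^q)`, `s + jb = q + 1`, `mb·2^s ≤ Y < (mb+1)·2^s`. -/
theorem trunc_facts {q Y : ℕ} (hq : 1 ≤ q) (hlo : 2 ^ q ≤ Y) (hhi : Y < 2 ^ (2 * q + 1)) :
    2 ^ (q - 1) ≤ Y / 2 ^ (Nat.log2 Y + 1 - q) ∧ Y / 2 ^ (Nat.log2 Y + 1 - q) < 2 ^ q ∧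
    (Nat.log2 Y + 1 - q) + (2 * q - Nat.log2 Y) = q + 1 ∧
    Y / 2 ^ (Nat.log2 Y + 1 - q) * 2 ^ (Nat.log2 Y + 1 - q) ≤ Y ∧
    Y < (Y / 2 ^ (Nat.log2 Y + 1 - q) + 1) * 2 ^ (Nat.log2 Y + 1 - q) := by
  have hY0 : Y ≠ 0 := by have := Nat.one_le_two_pow (n := q); omega
  set L := Nat.log2 Y with hL
  have h1 : 2 ^ L ≤ Y := Nat.log2_self_le hY0
  have h2 : Y < 2 ^ (L + 1) := Nat.lt_log2_self
  -- q ≤ L ≤ 2q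
  have hqL : q ≤ L := by
    by_contra hc
    have : 2 ^ (L + 1) ≤ 2 ^ q := Nat.pow_le_pow_right (by norm_num) (by omega)
    omega
  have hL2 : L ≤ 2 * q := by
    by_contra hc
    have : 2 ^ (2 * q + 1) ≤ 2 ^ L := Nat.pow_le_pow_right (by norm_num) (by omega)
    omega
  set s := L + 1 - q with hs
  have hspos : 0 < 2 ^ s := by positivity
  refine ⟨?_, ?_, by omega, Nat.div_mul_le_self Y (2 ^ s), ?_⟩
  · -- 2^(q-1) * 2^s = 2^L ≤ Y
    rw [Nat.le_div_iff_mul_le hspos, ← pow_add]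
    have : q - 1 + s = L := by omega
    rw [this]; exact h1
  · -- Y < 2^(L+1) = 2^q * 2^s
    rw [Nat.div_lt_iff_lt_mul hspos, ← pow_add]
    have : q + s = L + 1 := by omega
    rw [this]; exact h2
  · calc Y < Y / 2 ^ s * 2 ^ s + 2 ^ s := Nat.lt_div_mul_add hspos
      _ = (Y / 2 ^ s + 1) * 2 ^ s := by ring

/-- **Specification of `bmax`.**  Let `m ∈ [2^(q-1), 2^q)`, `a = ma/2^ja` a grid value of depth
`ja ≤ q+1` with `a ≤ m`, `A = ma·2^(q+1-ja)`, `(mb, jb) = bmax q m A`.  Then `(mb, jb)` is a grid value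
with `mb/2^jb ≤ m` and `mb/2^jb + a ≤ m + ½`, and it dominates every grid value `n/2^k` (any depth)
with `n/2^k ≤ m` and `n/2^k + a ≤ m + ½`. -/
theorem bmax_spec {q : ℕ} (hq : 1 ≤ q) {m ma ja : ℕ} (hm : 2 ^ (q - 1) ≤ m) (hm' : m < 2 ^ q)
    (hma' : ma < 2 ^ q) (hja : ja ≤ q + 1)
    (hle : (ma : ℚ) / 2 ^ ja ≤ m) :
    2 ^ (q - 1) ≤ (bmax q m (ma * 2 ^ (q + 1 - ja))).1 ∧ (bmax q m (ma * 2 ^ (q + 1 - ja))).1 < 2 ^ q ∧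
    ((bmax q m (ma * 2 ^ (q + 1 - ja))).1 : ℚ) / 2 ^ (bmax q m (ma * 2 ^ (q + 1 - ja))).2 ≤ m ∧
    ((bmax q m (ma * 2 ^ (q + 1 - ja))).1 : ℚ) / 2 ^ (bmax q m (ma * 2 ^ (q + 1 - ja))).2
      + (ma : ℚ) / 2 ^ ja ≤ m + 1 / 2 ∧
    ∀ n k : ℕ, 2 ^ (q - 1) ≤ n → n < 2 ^ q → (n : ℚ) / 2 ^ k ≤ m →
      (n : ℚ) / 2 ^ k + (ma : ℚ) / 2 ^ ja ≤ m + 1 / 2 →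
      (n : ℚ) / 2 ^ k ≤ ((bmax q m (ma * 2 ^ (q + 1 - ja))).1 : ℚ) / 2 ^ (bmax q m (ma * 2 ^ (q + 1 - ja))).2 := by
  have hH : (1 : ℚ) ≤ 2 ^ (q - 1) := one_le_pow₀ (by norm_num)
  have hm1 : (1 : ℚ) ≤ m := le_trans hH (by exact_mod_cast hm)
  -- the unit 2^-(q+1): a = A / 2^(q+1)
  obtain ⟨d, hd⟩ : ∃ d, q + 1 = ja + d := ⟨q + 1 - ja, by omega⟩
  have hdsub : q + 1 - ja = d := by omega
  rw [hdsub]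
  have haA : (ma : ℚ) / 2 ^ ja = ((ma * 2 ^ d : ℕ) : ℚ) / 2 ^ (q + 1) := by
    rw [hd, pow_add]; push_cast; field_simp
  by_cases hsmall : ma * 2 ^ d ≤ 2 ^ q
  · -- a ≤ ½ : bmax = (m, 0)
    have hb : bmax q m (ma * 2 ^ d) = (m, 0) := by unfold bmax; exact if_pos hsmall
    have ha12 : (ma : ℚ) / 2 ^ ja ≤ 1 / 2 := by
      rw [haA, div_le_div_iff₀ (by positivity) (by norm_num), pow_succ]
      have : ((ma * 2 ^ d : ℕ) : ℚ) ≤ 2 ^ q := by exact_mod_cast hsmall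
      linarith
    rw [hb]
    refine ⟨hm, hm', by simp, by simp; linarith, fun n k _ _ hnm _ => by simpa using hnm⟩
  · -- a > ½ : truncation of Y = m 2^(q+1) + 2^q - A
    rw [not_le] at hsmall
    have hAle : ma * 2 ^ d ≤ m * 2 ^ (q + 1) := by
      have h1 : ((ma * 2 ^ d : ℕ) : ℚ) / 2 ^ (q + 1) ≤ m := by rw [← haA]; exact hle
      rw [div_le_iff₀ (by positivity)] at h1
      exact_mod_cast h1
    set A := ma * 2 ^ d with hA
    set Y := m * 2 ^ (q + 1) + 2 ^ q - A with hY
    have hb : bmax q m A = (Y / 2 ^ (Nat.log2 Y + 1 - q), 2 * q - Nat.log2 Y) := by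
      unfold bmax; rw [if_neg (not_le.mpr hsmall)]
    rw [hb]
    have hYq : (Y : ℚ) = (m : ℚ) * 2 ^ (q + 1) + 2 ^ q - A := by
      rw [hY]; push_cast [Nat.cast_sub (by omega : A ≤ m * 2 ^ (q + 1) + 2 ^ q)]; ring
    -- y = Y / 2^(q+1) = m + 1/2 - a
    have hy : (Y : ℚ) / 2 ^ (q + 1) = m + 1 / 2 - (ma : ℚ) / 2 ^ ja := by
      rw [haA, hYq, pow_succ]; field_simp
    have hYlo : 2 ^ q ≤ Y := by omega
    have hYhi : Y < 2 ^ (2 * q + 1) := by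
      have hq2 : 2 ^ (2 * q + 1) = 2 ^ q * 2 ^ (q + 1) := by rw [← pow_add]; congr 1; omega
      have hm2 : m * 2 ^ (q + 1) + 2 ^ q ≤ (2 ^ q - 1) * 2 ^ (q + 1) + 2 ^ q :=
        Nat.add_le_add_right (Nat.mul_le_mul_right _ (by omega)) _
      have h3 : (2 ^ q - 1) * 2 ^ (q + 1) + 2 ^ (q + 1) = 2 ^ q * 2 ^ (q + 1) := by
        rw [← Nat.succ_mul]; congr 1; have := Nat.one_le_two_pow (n := q); omega
      have h4 : 2 ^ q < 2 ^ (q + 1) := Nat.pow_lt_pow_right (by norm_num) (by omega)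
      omega
    obtain ⟨hmb, hmb', hsum, hdivle, hltdiv⟩ := trunc_facts hq hYlo hYhi
    set L := Nat.log2 Y with hL
    set s := L + 1 - q with hs
    set mb := Y / 2 ^ s with hmbdef
    set jb := 2 * q - L with hjb
    -- 2^(q+1) = 2^s * 2^jb
    have hpow : (2 : ℚ) ^ (q + 1) = 2 ^ s * 2 ^ jb := by rw [← pow_add, hsum]
    -- value of (mb, jb): mb / 2^jb = mb 2^s / 2^(q+1) ≤ Y / 2^(q+1)
    have hval : (mb : ℚ) / 2 ^ jb = ((mb * 2 ^ s : ℕ) : ℚ) / 2 ^ (q + 1) := by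
      rw [hpow]; push_cast; field_simp
    have hval_le : (mb : ℚ) / 2 ^ jb ≤ (Y : ℚ) / 2 ^ (q + 1) := by
      rw [hval]; exact div_le_div_of_nonneg_right (by exact_mod_cast hdivle) (by positivity)
    have ha0 : (0 : ℚ) ≤ (ma : ℚ) / 2 ^ ja := by positivity
    have ha12 : (1 : ℚ) / 2 < (ma : ℚ) / 2 ^ ja := by
      rw [haA, div_lt_div_iff₀ (by norm_num) (by positivity), pow_succ]
      have : (2 : ℚ) ^ q < ((ma * 2 ^ d : ℕ) : ℚ) := by exact_mod_cast hsmall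
      linarith
    rw [hy] at hval_le
    refine ⟨hmb, hmb', by linarith, by linarith, ?_⟩
    intro n k hn hn' hnm hny
    have hny' : (n : ℚ) / 2 ^ k ≤ (Y : ℚ) / 2 ^ (q + 1) := by rw [hy]; linarith
    rcases lt_trichotomy jb k with hlt | heq | hgt
    · -- k > jb : n/2^k < 2^q/2^k ≤ 2^(q-1)/2^jb ≤ mb/2^jb
      have h1 : (n : ℚ) / 2 ^ k < (2 : ℚ) ^ q / 2 ^ k :=
        div_lt_div_of_pos_right (by exact_mod_cast hn') (by positivity)
      have h3 : (2 : ℚ) ^ q / 2 ^ k ≤ (2 : ℚ) ^ q / 2 ^ (jb + 1) :=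
        div_le_div_of_nonneg_left (by positivity) (by positivity)
          (pow_le_pow_right₀ (by norm_num) (by omega))
      have h4 : (2 : ℚ) ^ q / 2 ^ (jb + 1) = (2 : ℚ) ^ (q - 1) / 2 ^ jb := by
        obtain ⟨e, he⟩ : ∃ e, q = e + 1 := ⟨q - 1, by omega⟩
        rw [he, Nat.add_sub_cancel, pow_succ, pow_succ]; field_simp
      have h5 : (2 : ℚ) ^ (q - 1) / 2 ^ jb ≤ (mb : ℚ) / 2 ^ jb :=
        div_le_div_of_nonneg_right (by exact_mod_cast hmb) (by positivity)
      linarith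
    · -- k = jb : n 2^s ≤ Y hence n ≤ Y / 2^s = mb
      subst heq
      have h1 : (n : ℚ) * 2 ^ s ≤ Y := by
        have h6 := hny'
        rw [hpow, div_le_div_iff₀ (by positivity) (by positivity)] at h6
        -- h6 : n * (2^s * 2^jb) ≤ Y * 2^jb
        have hjpos : (0 : ℚ) < 2 ^ jb := by positivity
        nlinarith
      have h1n : n * 2 ^ s ≤ Y := by exact_mod_cast h1
      have h7 : n ≤ mb := (Nat.le_div_iff_mul_le (by positivity)).mpr h1n
      exact div_le_div_of_nonneg_right (by exact_mod_cast h7) (by positivity)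
    · -- k < jb : n/2^k ≥ 2^(q-1)/2^k ≥ 2^q/2^jb > Y/2^(q+1) ≥ n/2^k, contradiction
      exfalso
      have h1 : (2 : ℚ) ^ (q - 1) / 2 ^ k ≤ (n : ℚ) / 2 ^ k :=
        div_le_div_of_nonneg_right (by exact_mod_cast hn) (by positivity)
      have h3 : (2 : ℚ) ^ q / 2 ^ jb ≤ (2 : ℚ) ^ (q - 1) / 2 ^ k := by
        have h4 : (2 : ℚ) ^ q / 2 ^ jb ≤ (2 : ℚ) ^ q / 2 ^ (k + 1) :=
          div_le_div_of_nonneg_left (by positivity) (by positivity)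
            (pow_le_pow_right₀ (by norm_num) (by omega))
        have h5 : (2 : ℚ) ^ q / 2 ^ (k + 1) = (2 : ℚ) ^ (q - 1) / 2 ^ k := by
          obtain ⟨e, he⟩ : ∃ e, q = e + 1 := ⟨q - 1, by omega⟩
          rw [he, Nat.add_sub_cancel, pow_succ, pow_succ]; field_simp
        linarith
      have h5 : (Y : ℚ) / 2 ^ (q + 1) < (2 : ℚ) ^ q / 2 ^ jb := by
        have h6 : (Y : ℚ) < ((mb + 1) * 2 ^ s : ℕ) := by exact_mod_cast hltdiv
        have h7 : (((mb + 1) * 2 ^ s : ℕ) : ℚ) ≤ (2 : ℚ) ^ q * 2 ^ s := by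
          have : (mb + 1) * 2 ^ s ≤ 2 ^ q * 2 ^ s := Nat.mul_le_mul_right _ (by omega)
          exact_mod_cast this
        rw [hpow, div_lt_div_iff₀ (by positivity) (by positivity)]
        have hjpos : (0 : ℚ) < 2 ^ jb := by positivity
        nlinarith
      linarith

end Summit.Ventures.CertifiedArithmetic.LowPrec.Opt
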